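import Literature.MathematicalPhysics.QuantumFieldTheory.Balaban1983to89.Node00.Record13CarriersXPinnedHSCoPR
import Literature.MathematicalPhysics.QuantumFieldTheory.Balaban1983to89.Node00.N24ItemsStage13SepCoPR

/-!
v1.6 `CoPR` IMAGE (KEY-RULE-25, node00-def-T `KEYMAP-Record13-v1.6.md`: binder `θ : Stage13RParams`, `CoP ↦ CoPR`, SITE-RULE `X F N θ ↦ X F N θ.toStage13Params` for the edition-free θ-level objects) of this seat's v1.5 file of the same stem; the v1.5 file STANDS (settled helper); R-level pins over dag-n10-d's `Stage13RParams.rebindX` (`Node00/Record13CarriersCoPR` §0).  Prose pids ∕ FILE numbers below are those of the v1.5 `CoP` lineage where not updated; this image's v1.6 suppliers are node00-def-T FILE 25 p529474 `Record13CoPR` ∕ FILE 26T p529780 `Record13SepCoPR` and dag-n10-d g9 p530591 `Record13CarriersCoPR` + its `Record13CarriersSepCoPR`.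

# NODE 00 (YM-PLAN Track A) — THE S-BOUND RECORD AT THE K1 ENGINE's WORLD SHAPE: `IsRecordOfRecord₁₃CSepCoPRSX3HV` — def-T's `IsRecordOfRecord₁₃CSepCoPR` VERBATIM except that the
# world is bound by the S-BINDING `upOfRecord₅CS` over the FOUR-PIN v1.6 VIEW `(θ.pinX3H lam8 lam12 lam13).view₁₃CoPRB10YZW Mstar ops ζ lamW` (the exact view dag-n10-d's engine
# closers `BalabanUVNodesN10XPinnedHClosers13SepCoPR` bind, with `b8` re-bound to the SURVIVING leaf): ONE world with N05's surviving slot `B8LeafOfRecordSubBH θ₃ lam8`, the N09 ∕ N10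
# X-sockets at `lam12 ∕ lam13`, N06 ∕ N07 ∕ N12 at the Y ∕ Z ∕ W pins and N08 printed — companion in `IsRecordOfRecord₁₃CSepCoPR`, the reading, the slot form, the rebind, AND the
# (B)-from-nodes transfer `endStatementBPrinted_of_…_of_nodes` (the K1⁶ rung-v4 composition lemma, plan g69 WORD-K1V3-B8 option (i))

NODE 00 RECORD MODULE (seat `pub-ymgap-dag-n05-d` g6, 2026-08-27; APPEND-ONLY, everything BY NAME).  = this seat's `Record13CarriersXPinnedHS` (p526966) with the view
`(θ.pinX3H …).toStage5₁₃CoPR` replaced by the four-pin view over it — the plan's «if the table says the integration world is the FOUR-PIN X-H VIEW» variant, typed in advance so v4 can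
name either record.  The companion is dag-n24-c's X′-generic `N24_isRecordOfRecord₁₃CSepCoPR_of_up_rebindX_view₁₃CoPRB10YZW` at `X' := XPinned₁₃H …` (`pinX3H = rebindX (XPinned₁₃H …)`,
`rfl`); the (B) transfer is `Record5.endStatementBPrinted_of_nodesP_interval_guarded` exactly as in `Record13CarriersSBoundNodes`.
WHAT IS DEFINED ∕ PROVED: §1 ★ `socket05S_view₁₃CoPRB10YZW_pinX3H_iff` (`Iff.rfl`: `b8 ↔ B8LeafOfRecordSubBH θ₃ lam8`), `upOfRecord₅CS_view₁₃CoPRB10YZW_pinX3H_offB8` (`rfl` ×5) (the named leaves rBasicStep ∕ b9 ∕ b10 ∕ b11 of the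
C-binding at that view are dag-n10-d's `upOfRecord₅C_view₁₃CoPRB10YZW_leaves` at `θ.pinX3H …`, cited, not restated); §2 `IsRecordOfRecord₁₃CSepCoPRSX3HV` (def), `exists_world_…`, `companion_of_…`, `leaf_b8_iff_of_…`,
`leaf_b8_iff_subB_and_t8H_of_…`, `exists_isRecordOfRecord₁₃CSepCoPR_of_…`, `exists_isRecordOfRecord₁₃CCoPR_of_…`, `b4_b5_b6_b7_of_…`, `b8_b11_b10_main_iff_of_…`, `b8_main_of_…_of_slot`,
`b8_main_of_…_of_subB_fields`, `…_rebind_of_isRecordOfRecord₁₃CSepCoPR`, `exists_provisos_of_…`; §3 `rgFlow_of_smallCouplings_of_…`, ★ `endStatementBPrinted_of_isRecordOfRecord₁₃CSepCoPRSX3HV_of_nodes`.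
HONEST FRAMING: one definition + kernel bookkeeping; NO estimate; nothing of Bałaban's asserted; (B) derived only from the HYPOTHESIS «all nodes at every run» + β bounds; N05 NOT
discharged; K1 NOT claimed; counts unmoved; one finite T⁴ programme at fixed ε — NOT continuum ∕ ℝ⁴ ∕ OS ∕ mass gap ∕ Clay.  No `sorry`, no `axiom`, no `instance`, no `notation`.
[Balaban1985RegularSpaces] = Commun. Math. Phys. **99** (1985) 75–102; [Balaban1989LargeFieldII] = Commun. Math. Phys. **122** (1989) 355–392; [Balaban1988Convergent] = Commun.
Math. Phys. **119** (1988) 243–285.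
-/
noncomputable section

namespace Literature.MathematicalPhysics.QuantumFieldTheory.Balaban1983to89.Node00

open T4Continuum AveragingRT T4FiniteEpsInhabited FlowStep FlowStepRuns DagBinding T4DatumAssembly
open B8LeafKnitRS (B8LeafRS)
open B8IdxB8LawsB (IdxB8SubB famB8OfRecordSubB)
open scoped Matrix.Norms.L2Operator

/-! ## §1. N05's SURVIVING socket and the off-`b8` leaves at the four-pin v1.6 view of the H-X-pinned parameter -/

section SocketsView

variable (F : T4Family) (N : ℕ) [NeZero N]
variable (θ : Stage13RParams F N) (lam8 : ResidB8 θ.toStage3Params) (lam12 : ResidB12 F N θ.τ9.M)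
  (lam13 : B12.RunParams → ResidB13 θ.toStage3Params) (Mstar : ℕ) (ops : OpsY N θ.toStage3Params Mstar) (ζ : ResidZ F N) (lamW : ResidW F N) (P : B12.RunParams)

/-- ★ **THE `b8` LEAF OF THE S-BINDING OVER THE FOUR-PIN v1.6 VIEW OF THE H-X-PINNED PARAMETER IS THE REPAIRED SLOT `B8LeafOfRecordSubBH θ₃ lam8`** (`Iff.rfl`: the [B10] ∕ Y ∕ Z ∕ W pins do
not touch the [B8] group). [cite: Balaban1985RegularSpaces, Lemma 1 – Thm 8 pp.79–101, Thm 8 (1.146) p.101 (the surviving leaf at the repaired objects of record)] -/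
theorem socket05S_view₁₃CoPRB10YZW_pinX3H_iff :
    (upOfRecord₅CS F N ((θ.pinX3H F N lam8 lam12 lam13).view₁₃CoPRB10YZW F N Mstar ops ζ lamW) P).b8 ↔ B8LeafOfRecordSubBH θ.toStage3Params lam8 :=
  Iff.rfl

/-- The other leaves of the S-binding over that view are the C-binding's (`rfl` ×5). [cite: Balaban1989LargeFieldII, Thm 1 p.355 (bookkeeping)] -/
theorem upOfRecord₅CS_view₁₃CoPRB10YZW_pinX3H_offB8 :
    (upOfRecord₅CS F N ((θ.pinX3H F N lam8 lam12 lam13).view₁₃CoPRB10YZW F N Mstar ops ζ lamW) P).b9 =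
      (upOfRecord₅C F N ((θ.pinX3H F N lam8 lam12 lam13).view₁₃CoPRB10YZW F N Mstar ops ζ lamW) P).b9 ∧
    (upOfRecord₅CS F N ((θ.pinX3H F N lam8 lam12 lam13).view₁₃CoPRB10YZW F N Mstar ops ζ lamW) P).b10 =
      (upOfRecord₅C F N ((θ.pinX3H F N lam8 lam12 lam13).view₁₃CoPRB10YZW F N Mstar ops ζ lamW) P).b10 ∧
    (upOfRecord₅CS F N ((θ.pinX3H F N lam8 lam12 lam13).view₁₃CoPRB10YZW F N Mstar ops ζ lamW) P).b11 =
      (upOfRecord₅C F N ((θ.pinX3H F N lam8 lam12 lam13).view₁₃CoPRB10YZW F N Mstar ops ζ lamW) P).b11 ∧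
    (upOfRecord₅CS F N ((θ.pinX3H F N lam8 lam12 lam13).view₁₃CoPRB10YZW F N Mstar ops ζ lamW) P).b12 =
      (upOfRecord₅C F N ((θ.pinX3H F N lam8 lam12 lam13).view₁₃CoPRB10YZW F N Mstar ops ζ lamW) P).b12 ∧
    (upOfRecord₅CS F N ((θ.pinX3H F N lam8 lam12 lam13).view₁₃CoPRB10YZW F N Mstar ops ζ lamW) P).rBasicStep =
      (upOfRecord₅C F N ((θ.pinX3H F N lam8 lam12 lam13).view₁₃CoPRB10YZW F N Mstar ops ζ lamW) P).rBasicStep :=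
  ⟨rfl, rfl, rfl, rfl, rfl⟩

end SocketsView

/-! ## §2. The S-bound four-pin X-H record at the v1.6 key; companion in `₁₃CSepCoPR`; faces; the reading; rebind -/

section Record13SepCoPRSX3HV

variable (F : T4Family) (N : ℕ) [NeZero N]

/-- **«(D, w) is the record, Stage 13 (separated range), [B8] group pinned over the four-law sub-index ON THE REPAIRED CARRIER, `b8` surviving»**: def-T's
`IsRecordOfRecord₁₃CSepCoPR` VERBATIM except that the world is bound by the S-binding over the FOUR-PIN v1.6 VIEW OF THE H-X-PINNED parameter (`(θ.pinX3H lam8 lam12 lam13).view₁₃CoPRB10YZW Mstar ops ζ lamW` — the K1 engine's world shape, dag-n10-d `BalabanUVNodesN10XPinnedHClosers13SepCoPR`), for SOME layers.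
[cite: Balaban1985RegularSpaces, Lemma 1 – Thm 8 pp.79–101, Thm 8 (1.146) p.101, (1.12) p.78; Balaban1989LargeFieldII, Thm 1 + (0.1) pp.355–356 (objects of record)] -/
def IsRecordOfRecord₁₃CSepCoPRSX3HV (D : FiniteEpsData F (SU N)) (w : WorldP) : Prop :=
  ∃ (θ : Stage13RParams F N) (h : θ.Provisos₁₃SepCoPR F N) (lam8 : ResidB8 θ.toStage3Params) (lam12 : ResidB12 F N θ.τ9.M)
    (lam13 : B12.RunParams → ResidB13 θ.toStage3Params) (Mstar : ℕ) (ops : OpsY N θ.toStage3Params Mstar) (ζ : ResidZ F N) (lamW : ResidW F N),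
    θ.Admissible F N ∧ D = datumOfRecord₁₃SepCoPR F N θ h ∧ w.C = D.C ∧ (0 < w.γ ∧ w.γ ≤ θ.γ) ∧ w.L = (θ.L : ℝ) ∧
      ∀ P : B12.RunParams, w.up P = upOfRecord₅CS F N ((θ.pinX3H F N lam8 lam12 lam13).view₁₃CoPRB10YZW F N Mstar ops ζ lamW) P

/-- Inhabitation is Stage 13's exactly (the residual [B8] type is inhabited, `nonempty_residB8`): every admissible separated-range parameter presents a record of this module
at its own datum, ANY residual layer `lam`, any window. [cite: Balaban1989LargeFieldII, Thm 1 + (0.1) pp.355–356 (bookkeeping)] -/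
theorem exists_world_isRecordOfRecord₁₃CSepCoPRSX3HV (θ : Stage13RParams F N) (h : θ.Provisos₁₃SepCoPR F N) (hθ : θ.Admissible F N) (lam8 : ResidB8 θ.toStage3Params)
    (lam12 : ResidB12 F N θ.τ9.M) (lam13 : B12.RunParams → ResidB13 θ.toStage3Params) (Mstar : ℕ) (ops : OpsY N θ.toStage3Params Mstar)
    (ζ : ResidZ F N) (lamW : ResidW F N) {γw : ℝ} (hγw : 0 < γw ∧ γw ≤ θ.γ) :
    ∃ w : WorldP, IsRecordOfRecord₁₃CSepCoPRSX3HV F N (datumOfRecord₁₃SepCoPR F N θ h) w ∧ w.γ = γw ∧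
      ∀ P : B12.RunParams, w.up P = upOfRecord₅CS F N ((θ.pinX3H F N lam8 lam12 lam13).view₁₃CoPRB10YZW F N Mstar ops ζ lamW) P := by
  obtain ⟨w₀, -, -⟩ := exists_world_isRecordOfRecord₁₃CSepCoPR F N θ h hθ hγw
  exact ⟨{ w₀ with
      C := (datumOfRecord₁₃SepCoPR F N θ h).C, γ := γw, L := (θ.L : ℝ), one_lt_L := by exact_mod_cast θ.hL.2,
      up := fun P => upOfRecord₅CS F N ((θ.pinX3H F N lam8 lam12 lam13).view₁₃CoPRB10YZW F N Mstar ops ζ lamW) P },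
    ⟨θ, h, lam8, lam12, lam13, Mstar, ops, ζ, lamW, hθ, rfl, rfl, hγw, rfl, fun _ => rfl⟩, rfl, fun _ => rfl⟩

variable {F N}
variable {D : FiniteEpsData F (SU N)} {w : WorldP}

/-- **THE SAME-DATUM COMPANION IN `IsRecordOfRecord₁₃CSepCoPR`** (the C-bound world at the same four-pin X-H view): same `D`, `C`, window, `L`; leaves agree off `b8`; companion's
`b8` (typed, over the repaired sub-family) ⇒ record's `b8` (surviving) under the carrier law (1.36) ⊂ (1.62) — never conversely.
[cite: Balaban1985RegularSpaces, Thm 8 p.101 (surviving vs typed); Balaban1989LargeFieldII, Thm 1 + (0.1) pp.355–356 (bookkeeping)] -/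
theorem companion_of_isRecordOfRecord₁₃CSepCoPRSX3HV (h : IsRecordOfRecord₁₃CSepCoPRSX3HV F N D w) :
    ∃ w' : WorldP, IsRecordOfRecord₁₃CSepCoPR F N D w' ∧ w'.C = w.C ∧ w'.γ = w.γ ∧ w'.L = w.L ∧
      (∀ P : B12.RunParams, leavesP w P = { leavesP w' P with b8 := (leavesP w P).b8 }) ∧
      ∀ P : B12.RunParams, (leavesP w' P).b8 → (leavesP w P).b8 := by
  obtain ⟨θ, hP, lam8, lam12, lam13, Mstar, ops, ζ, lamW, hθ, hD, hC, hγ, hL, hup⟩ := h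
  subst hD
  have hup' : ∀ P, w.up P = (upOfRecord₅C F N ((θ.pinX3H F N lam8 lam12 lam13).view₁₃CoPRB10YZW F N Mstar ops ζ lamW) P).withB8 (leavesP w P).b8 := fun P => by
    show w.up P = (upOfRecord₅C F N _ P).withB8 (w.up P).b8
    rw [hup P]
    exact upOfRecord₅CS_eq_withB8 F N _ P
  -- the companion IS the C-bound record at the four-pin X-H view (dag-n24-c's X′-generic `N24_isRecordOfRecord₁₃CSepCoPR_of_up_rebindX_view₁₃CoPRB10YZW` at
  -- `X' := XPinned₁₃H …`; `pinX3H = rebindX (XPinned₁₃H …)` by `rfl`)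
  refine ⟨{ w with up := fun P => upOfRecord₅C F N ((θ.pinX3H F N lam8 lam12 lam13).view₁₃CoPRB10YZW F N Mstar ops ζ lamW) P },
    N24_isRecordOfRecord₁₃CSepCoPR_of_up_rebindX_view₁₃CoPRB10YZW θ hP hθ (XPinned₁₃H F N θ.toStage13Params lam8 lam12 lam13) Mstar ops ζ lamW _ hC hγ hL
      (fun _ => rfl), rfl, rfl, rfl,
      leavesP_eq_of_up_withB8 hup', fun P h8 => ?_⟩
  show (w.up P).b8
  rw [hup P]
  exact b8LeafOfRecordSubBH_of_b8LeafR (θ := θ.toStage3Params) lam8 h8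

/-- The `b8` leaf at a record of this module, for ONE parameter package: it IS the repaired slot. [cite: Balaban1985RegularSpaces, Lemma 1 – Thm 8 pp.79–101 (bookkeeping)] -/
theorem leaf_b8_iff_of_isRecordOfRecord₁₃CSepCoPRSX3HV (h : IsRecordOfRecord₁₃CSepCoPRSX3HV F N D w) :
    ∃ (θ : Stage13RParams F N) (lam : ResidB8 θ.toStage3Params), θ.Admissible F N ∧ w.L = (θ.L : ℝ) ∧
      ∀ P : B12.RunParams, (leavesP w P).b8 ↔ B8LeafOfRecordSubBH θ.toStage3Params lam := by
  obtain ⟨θ, -, lam8, lam12, lam13, Mstar, ops, ζ, lamW, hθ, -, -, -, hL, hup⟩ := h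
  refine ⟨θ, lam8, hθ, hL, fun P => ?_⟩
  show (w.up P).b8 ↔ _
  rw [hup P]
  exact socket05S_view₁₃CoPRB10YZW_pinX3H_iff F N θ lam8 lam12 lam13 Mstar ops ζ lamW P

/-- **THE READING AT THE RECORD**: at a record of this module the `b8` leaf is, for its presenting package, «the old pin's EIGHT non-Theorem-8 conjuncts (over `famB8OfRecordSubB`,
letter for letter the knits' conclusions) ∧ Theorem 8 surviving at γ = 1 AT THE REPAIRED MEMBERS» (`CarriersB8SubBH.b8LeafOfRecordSubBH_iff_subB_and_t8H`).
[cite: Balaban1985RegularSpaces, Lemma 1 p.79, Thm 2 p.83, Prop. 3 p.87, Thm 4 p.88, Prop. 5 p.94, Prop. 6 p.99, Prop. 7 p.100, Thm 8 (1.146) p.101] -/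
theorem leaf_b8_iff_subB_and_t8H_of_isRecordOfRecord₁₃CSepCoPRSX3HV (h : IsRecordOfRecord₁₃CSepCoPRSX3HV F N D w) :
    ∃ (θ : Stage13RParams F N) (lam : ResidB8 θ.toStage3Params), θ.Admissible F N ∧ w.L = (θ.L : ℝ) ∧
      ∀ P : B12.RunParams, (leavesP w P).b8 ↔
        (B8.Lemma1Printed θ.D (B8Lemma1NonAbelian.blockPairNA θ.D θ.L θ.𝔸) ∧
          B8.Thm2Printed (fun j : IdxB8SubB θ.toStage3Params => (famB8OfRecordSubB θ.toStage3Params lam.β lam.len j).toGFData) ∧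
          B8.Prop3Printed θ.D (θ.L : ℝ) lam.C₂ lam.inp lam.B₀β
            (fun j : IdxB8SubB θ.toStage3Params => (famB8OfRecordSubB θ.toStage3Params lam.β lam.len j).toGFData2) ∧
          B8.Thm4Printed lam.B₁' (fun j : IdxB8SubB θ.toStage3Params => (famB8OfRecordSubB θ.toStage3Params lam.β lam.len j).toGFData) ∧
          B8.Prop5Exists lam.inp.B₀' lam.B₁ lam.lan ∧ B8.Prop5Unique lam.lan ∧ B8.Prop6Printed θ.D (θ.L : ℝ) lam.B₁ lam.c₁ lam.cub ∧
          B8SectGH.Prop7PrintedR (fun j : IdxB8SubB θ.toStage3Params => famB8OfRecordSubB θ.toStage3Params lam.β lam.len j) (fun j => lam.toAxial j.1)) ∧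
        B8Thm8Surviving.Thm8SurvivingAt 1 lam.B₁ lam.B₂ (fun j : IdxB8SubB θ.toStage3Params => famB8OfRecordSubBH θ.toStage3Params lam.β lam.len j) := by
  obtain ⟨θ, lam, hθ, hL, hiff⟩ := leaf_b8_iff_of_isRecordOfRecord₁₃CSepCoPRSX3HV h
  exact ⟨θ, lam, hθ, hL, fun P => (hiff P).trans (b8LeafOfRecordSubBH_iff_subB_and_t8H lam)⟩

/-- A record of this module IS (through its companion) a separated-range Stage-13 record of the same datum at a world with the same `C ∕ γ ∕ L`.
[cite: Balaban1989LargeFieldII, Thm 1 + (0.1) pp.355–356 (bookkeeping)] -/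
theorem exists_isRecordOfRecord₁₃CSepCoPR_of_isRecordOfRecord₁₃CSepCoPRSX3HV (h : IsRecordOfRecord₁₃CSepCoPRSX3HV F N D w) :
    ∃ w' : WorldP, IsRecordOfRecord₁₃CSepCoPR F N D w' ∧ w'.C = w.C ∧ w'.γ = w.γ ∧ w'.L = w.L := by
  obtain ⟨w', hw', hC, hγ, hL, -, -⟩ := companion_of_isRecordOfRecord₁₃CSepCoPRSX3HV h
  exact ⟨w', hw', hC, hγ, hL⟩

/-- … hence (along `IsRecordOfRecord₁₃CSepCoPR.toCoPR`) a Co CORE Stage-13 record of the same datum at a world with the same `C ∕ γ ∕ L` — the projection by which storeys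
keyed ONCE on FILE 21's core family serve this record. [cite: Balaban1989LargeFieldII, Thm 1 + (0.1) pp.355–356 (bookkeeping)] -/
theorem exists_isRecordOfRecord₁₃CCoPR_of_isRecordOfRecord₁₃CSepCoPRSX3HV (h : IsRecordOfRecord₁₃CSepCoPRSX3HV F N D w) :
    ∃ w' : WorldP, IsRecordOfRecord₁₃CCoPR F N D w' ∧ w'.C = w.C ∧ w'.γ = w.γ ∧ w'.L = w.L := by
  obtain ⟨w', hw', hC, hγ, hL⟩ := exists_isRecordOfRecord₁₃CSepCoPR_of_isRecordOfRecord₁₃CSepCoPRSX3HV h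
  exact ⟨w', hw'.toCoPR, hC, hγ, hL⟩

/-- The in-edges `b4 b5 b6 b7` are THEOREMS at a record of this module (via the companion and def-T's v1.6 transfer `atWorld_of_isRecordOfRecord₁₃CSepCoPR`).
[cite: Balaban1983RegularityDecay, Thm p.573; Balaban1984PropagatorsI, Props. 1.1–1.2 pp.33–36; Balaban1984PropagatorsII, pp.223–250; Balaban1985Averaging, Props. 1–10 pp.26–50 (bookkeeping)] -/
theorem b4_b5_b6_b7_of_isRecordOfRecord₁₃CSepCoPRSX3HV (h : IsRecordOfRecord₁₃CSepCoPRSX3HV F N D w) (P : B12.RunParams) :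
    (leavesP w P).b4 ∧ (leavesP w P).b5 ∧ (leavesP w P).b6 ∧ (leavesP w P).b7 := by
  obtain ⟨w', hw', -, -, -, hleaves, -⟩ := companion_of_isRecordOfRecord₁₃CSepCoPRSX3HV h
  have h' : (leavesP w' P).b4 ∧ (leavesP w' P).b5 ∧ (leavesP w' P).b6 ∧ (leavesP w' P).b7 :=
    atWorld_of_isRecordOfRecord₁₃CSepCoPR (X := fun ℓ => ℓ.b4 ∧ ℓ.b5 ∧ ℓ.b6 ∧ ℓ.b7)
      (fun _ _ h5 P =>
        have h4 := b4_main_of_isRecordOfRecord₅C h5 P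
        have hb5 := b5_main_of_isRecordOfRecord₅C h5 P h4
        ⟨h4, hb5, N03_at_record₅C h5 P h4 hb5, b7_main_of_isRecordOfRecord₅C h5 P hb5⟩) hw' P
  rw [hleaves P]
  exact h'

/-- **N05 ∕ N07 ∕ N08 AT A RECORD OF THIS MODULE** (in-edges b4–b7 are theorems). [cite: Balaban1985RegularSpaces, Thm 2 p.83, Thm 8 p.101; Balaban1985Variational, Thm 1 p.279; Balaban1985UV3, Thm 1 p.257 (bookkeeping)] -/
theorem b8_b11_b10_main_iff_of_isRecordOfRecord₁₃CSepCoPRSX3HV (h : IsRecordOfRecord₁₃CSepCoPRSX3HV F N D w) (P : B12.RunParams) :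
    (Dag.B8_main (leavesP w P) ↔ ((leavesP w P).b9 → (leavesP w P).b8)) ∧
    (Dag.B11_main (leavesP w P) ↔ ((leavesP w P).b8 → (leavesP w P).b9 → (leavesP w P).b11)) ∧
    (Dag.B10_main (leavesP w P) ↔ ((leavesP w P).b8 → (leavesP w P).b9 → (leavesP w P).b11 → (leavesP w P).b10)) := by
  obtain ⟨-, h5, h6, h7⟩ := b4_b5_b6_b7_of_isRecordOfRecord₁₃CSepCoPRSX3HV h P
  exact ⟨⟨fun hN h9 => hN h5 h6 h7 h9, fun hN _ _ _ => hN⟩, ⟨fun hN h8 h9 => hN h5 h6 h7 h8 h9, fun hN _ _ _ => hN⟩,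
    ⟨fun hN h8 h9 h11 => hN h5 h6 h7 h8 h9 h11, fun hN _ _ _ => hN⟩⟩

/-- **N05 «SLOT» FORM at a record of this module**: a closer of the REPAIRED slot `B8LeafOfRecordSubBH` at every presenting package gives `Dag.B8_main` at every run.
[cite: Balaban1985RegularSpaces, Lemma 1 – Thm 8 pp.79–101, Thm 8 (1.146) p.101 (the node's shape, bookkeeping)] -/
theorem b8_main_of_isRecordOfRecord₁₃CSepCoPRSX3HV_of_slot (h : IsRecordOfRecord₁₃CSepCoPRSX3HV F N D w)
    (hB : ∀ (θ : Stage13RParams F N) (hP : θ.Provisos₁₃SepCoPR F N) (lam8 : ResidB8 θ.toStage3Params) (lam12 : ResidB12 F N θ.τ9.M)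
      (lam13 : B12.RunParams → ResidB13 θ.toStage3Params) (Mstar : ℕ) (ops : OpsY N θ.toStage3Params Mstar) (ζ : ResidZ F N) (lamW : ResidW F N),
      θ.Admissible F N → D = datumOfRecord₁₃SepCoPR F N θ hP →
      (∀ P, w.up P = upOfRecord₅CS F N ((θ.pinX3H F N lam8 lam12 lam13).view₁₃CoPRB10YZW F N Mstar ops ζ lamW) P) → B8LeafOfRecordSubBH θ.toStage3Params lam8)
    (P : B12.RunParams) : Dag.B8_main (leavesP w P) := by
  obtain ⟨h8iff, -, -⟩ := b8_b11_b10_main_iff_of_isRecordOfRecord₁₃CSepCoPRSX3HV h P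
  obtain ⟨θ, hP, lam8, lam12, lam13, Mstar, ops, ζ, lamW, hθ, hD, -, -, -, hup⟩ := h
  refine h8iff.2 fun _ => ?_
  show (w.up P).b8
  rw [hup P]
  exact (socket05S_view₁₃CoPRB10YZW_pinX3H_iff F N θ lam8 lam12 lam13 Mstar ops ζ lamW P).2 (hB θ hP lam8 lam12 lam13 Mstar ops ζ lamW hθ hD hup)

/-- **N05 «SLOT» FORM, READ**: a supplier of the old pin's EIGHT conjuncts and of Theorem 8 surviving AT THE REPAIRED MEMBERS, at every presenting package, gives `Dag.B8_main` at
every run of a record of this module (the slot form through `b8LeafOfRecordSubBH_of_subB_fields`). [cite: Balaban1985RegularSpaces, Lemma 1 – Thm 8 pp.79–101, Thm 8 (1.146) p.101] -/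
theorem b8_main_of_isRecordOfRecord₁₃CSepCoPRSX3HV_of_subB_fields (h : IsRecordOfRecord₁₃CSepCoPRSX3HV F N D w)
    (hB : ∀ (θ : Stage13RParams F N) (hP : θ.Provisos₁₃SepCoPR F N) (lam : ResidB8 θ.toStage3Params) (lam12 : ResidB12 F N θ.τ9.M)
      (lam13 : B12.RunParams → ResidB13 θ.toStage3Params) (Mstar : ℕ) (ops : OpsY N θ.toStage3Params Mstar) (ζ : ResidZ F N) (lamW : ResidW F N),
      θ.Admissible F N → D = datumOfRecord₁₃SepCoPR F N θ hP →
      (∀ P, w.up P = upOfRecord₅CS F N ((θ.pinX3H F N lam lam12 lam13).view₁₃CoPRB10YZW F N Mstar ops ζ lamW) P) →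
        (B8.Lemma1Printed θ.D (B8Lemma1NonAbelian.blockPairNA θ.D θ.L θ.𝔸) ∧
          B8.Thm2Printed (fun j : IdxB8SubB θ.toStage3Params => (famB8OfRecordSubB θ.toStage3Params lam.β lam.len j).toGFData) ∧
          B8.Prop3Printed θ.D (θ.L : ℝ) lam.C₂ lam.inp lam.B₀β
            (fun j : IdxB8SubB θ.toStage3Params => (famB8OfRecordSubB θ.toStage3Params lam.β lam.len j).toGFData2) ∧
          B8.Thm4Printed lam.B₁' (fun j : IdxB8SubB θ.toStage3Params => (famB8OfRecordSubB θ.toStage3Params lam.β lam.len j).toGFData) ∧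
          B8.Prop5Exists lam.inp.B₀' lam.B₁ lam.lan ∧ B8.Prop5Unique lam.lan ∧ B8.Prop6Printed θ.D (θ.L : ℝ) lam.B₁ lam.c₁ lam.cub ∧
          B8SectGH.Prop7PrintedR (fun j : IdxB8SubB θ.toStage3Params => famB8OfRecordSubB θ.toStage3Params lam.β lam.len j) (fun j => lam.toAxial j.1)) ∧
        B8Thm8Surviving.Thm8SurvivingAt 1 lam.B₁ lam.B₂ (fun j : IdxB8SubB θ.toStage3Params => famB8OfRecordSubBH θ.toStage3Params lam.β lam.len j))
    (P : B12.RunParams) : Dag.B8_main (leavesP w P) :=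
  b8_main_of_isRecordOfRecord₁₃CSepCoPRSX3HV_of_slot h
    (fun θ hP lam lam12 lam13 Mstar ops ζ lamW hθ hD hup => (b8LeafOfRecordSubBH_iff_subB_and_t8H lam).2 (hB θ hP lam lam12 lam13 Mstar ops ζ lamW hθ hD hup)) P

/-- RE-BINDING a `₁₃CSep` record's world by the S-binding over the [B8″H]-pinned view gives a record of this module with the SAME datum — the ∃-currency entry point (the [B8]
layer `lam`, e.g. the cut layer `λ.cutSubB J lan c₁`, is CHOSEN here). [cite: Balaban1989LargeFieldII, Thm 1 p.355 (bookkeeping)] -/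
theorem isRecordOfRecord₁₃CSepCoPRSX3HV_rebind_of_isRecordOfRecord₁₃CSepCoPR (h : IsRecordOfRecord₁₃CSepCoPR F N D w) :
    ∃ (θ : Stage13RParams F N) (_ : θ.Provisos₁₃SepCoPR F N), θ.Admissible F N ∧ (∀ P, w.up P = upOfRecord₅C F N (θ.toStage5₁₃CoPR F N) P) ∧
      ∀ (lam8 : ResidB8 θ.toStage3Params) (lam12 : ResidB12 F N θ.τ9.M) (lam13 : B12.RunParams → ResidB13 θ.toStage3Params) (Mstar : ℕ)
        (ops : OpsY N θ.toStage3Params Mstar) (ζ : ResidZ F N) (lamW : ResidW F N),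
        IsRecordOfRecord₁₃CSepCoPRSX3HV F N D { w with up := fun P => upOfRecord₅CS F N ((θ.pinX3H F N lam8 lam12 lam13).view₁₃CoPRB10YZW F N Mstar ops ζ lamW) P } := by
  obtain ⟨θ, hP, hθ, hD, hC, hγ, hL, hup⟩ := h
  exact ⟨θ, hP, hθ, hup, fun lam8 lam12 lam13 Mstar ops ζ lamW => ⟨θ, hP, lam8, lam12, lam13, Mstar, ops, ζ, lamW, hθ, hD, hC, hγ, hL, fun _ => rfl⟩⟩

/-- Every record of this module sits at a v1.6 datum of record presented by admissible separated-range parameters (projection). [cite: Balaban1989LargeFieldII, Thm 1 + (0.1) pp.355–356 (bookkeeping)] -/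
theorem exists_provisos_of_isRecordOfRecord₁₃CSepCoPRSX3HV (h : IsRecordOfRecord₁₃CSepCoPRSX3HV F N D w) :
    ∃ (θ : Stage13RParams F N) (hP : θ.Provisos₁₃SepCoPR F N), θ.Admissible F N ∧ D = datumOfRecord₁₃SepCoPR F N θ hP := by
  obtain ⟨θ, hP, -, -, -, -, -, -, -, hθ, hD, -⟩ := h
  exact ⟨θ, hP, hθ, hD⟩

end Record13SepCoPRSX3HV

/-! ## §3. The (B)-from-nodes transfer at this record (the K1 rung-v4 composition lemma) -/

section NodesView

variable {F : T4Family} {N : ℕ} [NeZero N] {D : FiniteEpsData F (SU N)} {w : WorldP}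

/-- GUARDED (0.20) at every run: the `smallCouplings ∕ rgFlow` leaves are the C-bound companion's. [cite: Balaban1987RG1, (0.20) p.256 (bookkeeping)] -/
theorem rgFlow_of_smallCouplings_of_isRecordOfRecord₁₃CSepCoPRSX3HV (h : IsRecordOfRecord₁₃CSepCoPRSX3HV F N D w) (P : B12.RunParams)
    (hsc : (leavesP w P).smallCouplings) : (leavesP w P).rgFlow := by
  obtain ⟨w', hw', -, -, -, hleaves, -⟩ := companion_of_isRecordOfRecord₁₃CSepCoPRSX3HV h
  have h' := rgFlow_of_smallCouplings_of_isRecordOfRecord₁₃CSepCoPR hw' P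
  rw [hleaves P] at hsc ⊢
  exact h' hsc

/-- ★ **[III]'s END STATEMENT (B) AT THE DATUM FROM THE NODES AT THE WORLD** (def-T's `endStatementBPrinted_of_isRecordOfRecord₁₃CSepCoPR_of_nodes` with the record predicate
swapped). [cite: Balaban1988Convergent, Thm 2 + (2.45)–(2.50) pp.262–263; Balaban1989LargeFieldII, Thm 1 p.355 (bookkeeping)] -/
theorem endStatementBPrinted_of_isRecordOfRecord₁₃CSepCoPRSX3HV_of_nodes (h : IsRecordOfRecord₁₃CSepCoPRSX3HV F N D w) {γ₀ : ℝ} (hγ₀ : w.γ ≤ γ₀)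
    (hnodes : ∀ P, Nodes (leavesP w P)) (hβ : BetaBoundsInInterval w.C.toB12 γ₀ w.b w.βup) :
    B16.EndStatementBPrinted D.C := by
  have hrg := rgFlow_of_smallCouplings_of_isRecordOfRecord₁₃CSepCoPRSX3HV h
  obtain ⟨θ, hP, lam8, lam12, lam13, Mstar, ops, ζ, lamW, -, -, hC, hγ, -, -⟩ := h
  rw [← hC]
  exact endStatementBPrinted_of_nodesP_interval_guarded w hγ.1 hγ₀ hnodes hrg hβ

end NodesView

#print axioms companion_of_isRecordOfRecord₁₃CSepCoPRSX3HV
#print axioms endStatementBPrinted_of_isRecordOfRecord₁₃CSepCoPRSX3HV_of_nodes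

end Literature.MathematicalPhysics.QuantumFieldTheory.Balaban1983to89.Node00

end
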